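import Summits.CriticalPhenomena.PercolationContinuityZ3.Theorems.Transplant.KNLevelsTargetChain
import HarnessLib

/-!
# Transplant sharpness IV — the Lemma-11 packaging `KNLevels.linkIn_of_chain` (p217147) has jointly unsatisfiable hypotheses

builds on p205010 (kernel theorem, internal audit signed; external expert review pending).
Status sentence (coordinator 2026-08-20T04:30Z): "θ(p_c) = 0 on ℤ^d, all d ≥ 2 — kernel-verified (Lean 4/Mathlib,
standard axioms); internal adversarial audit SIGNED 2026-08-20 04:29Z; external expert review pending."

Lane `prim-bschramm`, seat p5 (refuter, generation 2); memo `run/shared/lean/prim/bschramm/P5-SHARPNESS.md` §17.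
A located obstruction, kernel-certified, about the lane's OWN generic layer (not about any graph):
`Transplant/KNCells2Elong.lean`'s `KNLevels.linkIn_of_chain` asks for a chain of target steps `s₀,…,s_n` with kits
(`(s i).KitsAt W p Δ' δ`, whose first conjunct is `KNLevels.LHyp (s i).L W p (s i).D (s i).R`) AND for the common source `o`
to lie in the first core, `o ∈ (s 0).L.X 0` (so that `real_reachB_eq_one` makes the source probability one).  But `LHyp`
contains `encl : X (R+1) ⊆ D`, `mono : Monotone X` and `o_not : o ∉ D`, so `X 0 ⊆ D ∌ o`: the two hypotheses contradict each
other for EVERY graph, weighting and chain.  Hence `linkIn_of_chain` is vacuously true and can never be instantiated (neither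
for `X □ ℤ²` nor in the `ℤ^d` regression).  Kozma–Nitzan's own Lemma 11 does not have a probability-one source: the wired cube
sits at the origin, FAR from the levels, and the first link "origin ↔ full face of `Λ_{L₀}`" is Lemma 9 with probability
`> 1 - δ` (the tree's `L/KozmaNitzanCorridor.lean`, `isHittable_elongGeom_of_target`, step `hinit`).  The repair is therefore:
drop `ho0`/`real_reachB_eq_one`, take the source `o` in the wired seed outside `D`, and feed `1 - δ < P_W(reachB)` for `s 0`
from the linked-face estimate of the seed's fat prism (Lemma 9-prod) — exactly as in print.
Everything here is PROVED; no definitions; standard axioms.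

References: G. Kozma, N. Nitzan, arXiv:2401.12397, §4 Lemma 10 (levels inside the subbox `D`, source outside `D`),
Lemma 11 (pp. 22–23: wired cube + Lemma 9 for the first face, then the chain).
-/

noncomputable section

namespace Summit.CriticalPhenomena.PercolationContinuityZ3.Theorems.TransplantSharpness

open Literature.Probability.Percolation Literature.Probability.LatticeModels
open Summit.CriticalPhenomena.PercolationContinuityZ3.Theorems.Transplant
open Summit.CriticalPhenomena.PercolationContinuityZ3.Theorems.Transplant.KNLevels

variable {V : Type*} [DecidableEq V]

/-- Under the level hypotheses `LHyp L W p D R` (levels up to `R+1` inside the subbox `D`, source outside `D`) the source `o`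
lies in NO level `X j`, `j ≤ R + 1`. [cite: KozmaNitzan2024, §4 Lemma 10 (p. 17: `B⟨R⟩ ⊆ D`, `0 ∉ D`)] -/
theorem source_notMem_level {G : SimpleGraph V} [G.LocallyFinite] {L : LData G} {W : Sym2 V → unitInterval}
    {p : unitInterval} {D : Finset V} {R : ℕ} (hL : LHyp L W p D R) {j : ℕ} (hj : j ≤ R + 1) : L.o ∉ L.X j :=
  fun h => hL.o_not (hL.X_subset_D hj h)

/-- A target step carrying kits (`TStep.KitsAt`, whose first conjunct is `LHyp`) cannot have its source in its first core
`X 0`. [folklore] -/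
theorem not_source_mem_core_of_kitsAt {G : SimpleGraph V} [G.LocallyFinite] {s : TStep G}
    {W : Sym2 V → unitInterval} {p : unitInterval} {Δ : ℕ} {δ : ℝ} (h : s.KitsAt W p Δ δ) : s.L.o ∉ s.L.X 0 :=
  source_notMem_level h.1 (Nat.zero_le _)

/-- **The hypotheses of `KNLevels.linkIn_of_chain` are jointly unsatisfiable**: a chain `s : Fin (n+1) → TStep G'` with common
source `o` (`ho`), the source in the first core (`ho0 : o ∈ (s 0).L.X 0`) and kits at every step (`hkits`) yields `False` — for
every graph `G'`, weighting `W`, parameters `p, Δ', δ` and length `n`.  So `linkIn_of_chain` (Transplant/KNCells2Elong.lean) is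
vacuous as stated; see the module docstring for the Kozma–Nitzan-faithful repair (Lemma 9 for the first link, source outside `D`).
[cite: KozmaNitzan2024, §4 Lemma 11 (pp. 22–23)] -/
theorem linkIn_of_chain_hypotheses_inconsistent {G' : SimpleGraph V} [G'.LocallyFinite] {p : unitInterval} {Δ' : ℕ}
    {δ : ℝ} {n : ℕ} (W : Sym2 V → unitInterval) (o : V) (s : Fin (n + 1) → TStep G')
    (ho : ∀ i : Fin (n + 1), (s i).L.o = o) (ho0 : o ∈ (s 0).L.X 0)
    (hkits : ∀ i : Fin (n + 1), (s i).KitsAt W p Δ' δ) : False := by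
  have h0 := not_source_mem_core_of_kitsAt (hkits 0)
  rw [ho 0] at h0
  exact h0 ho0

/-- Equivalent reading: whenever every step of a chain with common source `o` carries kits, the source is OUTSIDE the first
core — so the probability-one source lemma `real_reachB_eq_one` (which needs `o ∈ X_0(0)`) is never available together with
the kits, and the first link of a Lemma-11 chain must be paid for by an estimate (in print: Lemma 9, `> 1 - δ`).
[cite: KozmaNitzan2024, §4 Lemma 11 (pp. 22–23)] -/
theorem source_notMem_first_core_of_chain_kits {G' : SimpleGraph V} [G'.LocallyFinite] {p : unitInterval} {Δ' : ℕ}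
    {δ : ℝ} {n : ℕ} {W : Sym2 V → unitInterval} {o : V} {s : Fin (n + 1) → TStep G'}
    (ho : ∀ i : Fin (n + 1), (s i).L.o = o) (hkits : ∀ i : Fin (n + 1), (s i).KitsAt W p Δ' δ) :
    o ∉ (s 0).L.X 0 :=
  fun ho0 => linkIn_of_chain_hypotheses_inconsistent W o s ho ho0 hkits

end Summit.CriticalPhenomena.PercolationContinuityZ3.Theorems.TransplantSharpness

end
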